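import Literature.MathematicalPhysics.QuantumFieldTheory.Balaban1983to89.B1Eq324BenfattoSect5StepBound
import Literature.MathematicalPhysics.QuantumFieldTheory.Balaban1983to89.B1Eq324BenfattoSect5PerBoxErrBound
import Literature.MathematicalPhysics.QuantumFieldTheory.Balaban1983to89.B1Eq324BenfattoSect5CollectErrors
import HarnessLib

/-!
# Benfatto et al. 1978, §5 — the lower bound (4.7) of the Basic Lemma from ONE closed ledger inequality

doc: Literature/MathematicalPhysics/QuantumFieldTheory/Balaban1983to89/B1Eq324BenfattoLemma.md

This module ASSEMBLES the lower pavement chain of §5: starting from `J ⊆ I` and a coefficient `a`, it clips `a` to `J`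
(`…PavementChain.exists_coefSupportedIn_clip`), builds the `d + 1` translated pavements `J_{k+1} = (J_k + τ_k) ∩ Γ̄₁(B_k)` with the constant
diagonal shifts `τ_k ≡ −2(2w+v)·𝟙` (`…PavementChain.sep_of_diagonalShifts`), cut-offs `b_k = γ^k b`, runs `…StepBound.exists_lower_step` at every
step (per-box lower bounds + identification + closed cumulant-side errors), feeds the result to `…CollectErrors.ineq47_of_chain` (chain +
Appendix A + telescoping), and bounds every surviving cardinality by `|I|` (`|J_k| ≤ |J| ≤ |I|`, `|B_k| ≤ |J_k|`, `|Γ̄₁(B_k)| ≤ |B_k| L^d`,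
`Err(□) ≤ ErrPB` by `…PerBoxErrBound.perBoxErr_le`).  The outcome `ineq47_of_ledger` is (4.7) — `Ineq47 d α β t D s κ S ρ₁ ρ₂ ρ₃ ρ₄ b I J a` — from a
single CLOSED real inequality `Σ_{n<d+1} RAW_n(b, A, L, w, v, γ, δ, |I|) + |I|·k₁e^{−k₂(γ^{d+1}b)²} ≤ |I|·errTerm S ρ₁ ρ₂ ρ₃ ρ₄ A b t` (`A = coefSup`),
whose verification for the printed choice `L ≈ b²`, `w = 2v ≈ 2Mb^{3/2}`, `γ = (2(1+2d/α²))⁻¹` is elementary real analysis («Collecting all the errors», p.159).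
[cite: BenfattoEtAl1978, Basic Lemma (4.7) p.152; §5 pp.154–159; Appendix A p.160]

## Theorems
* `sum_le_card_mul` — `Σ_{m∈B} f m ≤ n·C` from `f ≤ C` on `B`, `0 ≤ C`, `|B| ≤ n`.
* `cumbHl_le`, `cumbPsi3_le`, `cumbRem_le`, `cumbCorr_le`, `cumbCross_le`, `cumbW29_le`, `cumb_le` — the closed cumulant-side error of `exists_lower_step` is monotone in the three cardinalities `|J|, |B|, |Γ̄₁(B)|`.
* ★ `ineq47_of_ledger` — (4.7) from the closed ledger inequality.
-/

namespace Literature.MathematicalPhysics.QuantumFieldTheory.Balaban1983to89.B1Eq324BenfattoSect5LowerAssembly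

open MeasureTheory ProbabilityTheory Finset
open scoped BigOperators Nat
open Literature.Probability.LatticeModels (setPartitions)
open Literature.MathematicalPhysics.QuantumFieldTheory
open Literature.MathematicalPhysics.QuantumFieldTheory.Balaban1983to89.B1Eq324BenfattoLemma
open Literature.MathematicalPhysics.QuantumFieldTheory.Balaban1983to89.B1Eq324BenfattoSect5Boxes
open Literature.MathematicalPhysics.QuantumFieldTheory.Balaban1983to89.B1Eq324BenfattoSect5Eq511
open Literature.MathematicalPhysics.QuantumFieldTheory.Balaban1983to89.B1Eq324BenfattoSect5Eq524
open Literature.MathematicalPhysics.QuantumFieldTheory.Balaban1983to89.B1Eq324BenfattoSect5Eq534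
open Literature.MathematicalPhysics.QuantumFieldTheory.Balaban1983to89.B1Eq324BenfattoSect5Eq515
open Literature.MathematicalPhysics.QuantumFieldTheory.Balaban1983to89.B1Eq324BenfattoSect5PavementStep
open Literature.MathematicalPhysics.QuantumFieldTheory.Balaban1983to89.B1Eq324BenfattoSect5PavementChain
open Literature.MathematicalPhysics.QuantumFieldTheory.Balaban1983to89.B1Eq324BenfattoSect5CollectErrors (ineq47_of_chain card_chain_le card_boxes_le)
open Literature.MathematicalPhysics.QuantumFieldTheory.Balaban1983to89.B1Eq324BenfattoSect5StepBound (exists_lower_step)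
open Literature.MathematicalPhysics.QuantumFieldTheory.Balaban1983to89.B1Eq324BenfattoSect5PerBoxErrBound
open Literature.MathematicalPhysics.QuantumFieldTheory.Balaban1983to89.B1Eq324BenfattoSect5IdErrBounds (latticeSumConst_nonneg)
open Literature.MathematicalPhysics.QuantumFieldTheory.Balaban1983to89.B1Eq324BenfattoSect5ErrTermLedger (s1Const_nonneg)
open Literature.MathematicalPhysics.QuantumFieldTheory.Balaban1983to89.B1Eq324GaussianMomentLeaf (momentConst)
open Literature.MathematicalPhysics.QuantumFieldTheory.Balaban1983to89.B1Eq324BenfattoSpecialisation (coefSup_nonneg)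
open Literature.MathematicalPhysics.QuantumFieldTheory.Balaban1983to89.B1Eq324BenfattoSect5Iteration

variable {d : ℕ}

/-- `Σ_{m ∈ B} f(m) ≤ n·C` when `f ≤ C` on `B`, `C ≥ 0` and `|B| ≤ n`. [folklore] [cite: BenfattoEtAl1978, p.159 «summing over the boxes»] -/
theorem sum_le_card_mul {ι : Type*} {B : Finset ι} {f : ι → ℝ} {C n : ℝ} (hf : ∀ m ∈ B, f m ≤ C) (hC : 0 ≤ C) (hB : (B.card : ℝ) ≤ n) :
    ∑ m ∈ B, f m ≤ n * C :=
  calc ∑ m ∈ B, f m ≤ ∑ _m ∈ B, C := Finset.sum_le_sum hf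
    _ = (B.card : ℝ) * C := by rw [Finset.sum_const, nsmul_eq_mul]
    _ ≤ n * C := mul_le_mul_of_nonneg_right hB hC

/-- One piece of the closed cumulant-side error (order-`k+1` term), monotone in the cardinality `x₁` — bookkeeping for `cumb_le`.
[cite: BenfattoEtAl1978, (5.11) p.155] -/
theorem cumbHl_le {α β : ℝ} {s D : ℕ} {κ δ A : ℝ} {w : ℕ} (hA : 0 ≤ A) (hδ : 0 ≤ δ) (hres : 0 ≤ κ / 2 - δ / 2 * ((D : ℝ) ^ 2 * Real.sqrt d))
    (k : ℕ) {x₁ y₁ : ℝ} (h : x₁ ≤ y₁) :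
    2 ^ (k + 1) * (2 ^ ((k + 1) * D) * 2 ^ 2 ^ ((k + 1) * D) * (max 1 (freeCov d α β 0 0)) ^ ((k + 1) * D)) * ((A * Real.exp (δ / 2 * ((D : ℝ) ^ 2 * d)) * Real.exp (-((κ / 2 - δ / 2 * ((D : ℝ) ^ 2 * Real.sqrt d)) / 2 * w))) * x₁ * ∑ p ∈ Finset.Icc 1 s, ((admissible p D).card : ℝ) * ((2 / (1 - Real.exp (-((κ / 2 - δ / 2 * ((D : ℝ) ^ 2 * Real.sqrt d)) / 2 / (p : ℕ) / Real.sqrt d))) * Real.exp ((κ / 2 - δ / 2 * ((D : ℝ) ^ 2 * Real.sqrt d)) / 2 / (p : ℕ) / Real.sqrt d)) ^ d) ^ (p - 1)) * (A * Real.exp (δ / 2 * ((D : ℝ) ^ 2 * d)) * ((1 : ℝ) * (2 / (1 - Real.exp (-(δ / (2 * ((k + 1 : ℕ) : ℝ)) / Real.sqrt d))) * Real.exp (δ / (2 * ((k + 1 : ℕ) : ℝ)) / Real.sqrt d)) ^ d) * ∑ p ∈ Finset.Icc 1 s, ((admissible p D).card : ℝ) * ((2 / (1 - Real.exp (-((κ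 / 2 - δ / 2 * ((D : ℝ) ^ 2 * Real.sqrt d)) / (p : ℕ) / Real.sqrt d))) * Real.exp ((κ / 2 - δ / 2 * ((D : ℝ) ^ 2 * Real.sqrt d)) / (p : ℕ) / Real.sqrt d)) ^ d) ^ (p - 1)) ^ k ≤
    2 ^ (k + 1) * (2 ^ ((k + 1) * D) * 2 ^ 2 ^ ((k + 1) * D) * (max 1 (freeCov d α β 0 0)) ^ ((k + 1) * D)) * ((A * Real.exp (δ / 2 * ((D : ℝ) ^ 2 * d)) * Real.exp (-((κ / 2 - δ / 2 * ((D : ℝ) ^ 2 * Real.sqrt d)) / 2 * w))) * y₁ * ∑ p ∈ Finset.Icc 1 s, ((admissible p D).card : ℝ) * ((2 / (1 - Real.exp (-((κ / 2 - δ / 2 * ((D : ℝ) ^ 2 * Real.sqrt d)) / 2 / (p : ℕ) / Real.sqrt d))) * Real.exp ((κ / 2 - δ / 2 * ((D : ℝ) ^ 2 * Real.sqrt d)) / 2 / (p : ℕ) / Real.sqrt d)) ^ d) ^ (p - 1)) * (A * Real.exp (δ / 2 * ((D : ℝ) ^ 2 * d)) * ((1 : ℝ) * (2 / (1 - Real.exp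 (-(δ / (2 * ((k + 1 : ℕ) : ℝ)) / Real.sqrt d))) * Real.exp (δ / (2 * ((k + 1 : ℕ) : ℝ)) / Real.sqrt d)) ^ d) * ∑ p ∈ Finset.Icc 1 s, ((admissible p D).card : ℝ) * ((2 / (1 - Real.exp (-((κ / 2 - δ / 2 * ((D : ℝ) ^ 2 * Real.sqrt d)) / (p : ℕ) / Real.sqrt d))) * Real.exp ((κ / 2 - δ / 2 * ((D : ℝ) ^ 2 * Real.sqrt d)) / (p : ℕ) / Real.sqrt d)) ^ d) ^ (p - 1)) ^ k := by
  have hM2 := latticeSumConst_nonneg (s := s) (D := D) (d := d) (c := κ / 2 - δ / 2 * ((D : ℝ) ^ 2 * Real.sqrt d)) hres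
  have hM3 := latticeSumConst_nonneg (s := s) (D := D) (d := d) (c := (κ / 2 - δ / 2 * ((D : ℝ) ^ 2 * Real.sqrt d)) / 2) (by linarith)
  have hg1 : 0 ≤ 2 / (1 - Real.exp (-(δ / (2 * ((k + 1 : ℕ) : ℝ)) / Real.sqrt d))) * Real.exp (δ / (2 * ((k + 1 : ℕ) : ℝ)) / Real.sqrt d) :=
    geom_nonneg (by positivity)
  have hg2 : 0 ≤ 2 / (1 - Real.exp (-(δ / (2 * ((k + 1 : ℕ) : ℝ)) / 2 / Real.sqrt d))) * Real.exp (δ / (2 * ((k + 1 : ℕ) : ℝ)) / 2 / Real.sqrt d) :=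
    geom_nonneg (by positivity)
  gcongr

/-- One piece of the closed cumulant-side error (order-`k+1` term), monotone in the cardinality `x₂` — bookkeeping for `cumb_le`.
[cite: BenfattoEtAl1978, (5.17)–(5.22) p.156] -/
theorem cumbPsi3_le {α β : ℝ} {s D : ℕ} {κ δ A : ℝ} {L v : ℕ} (hA : 0 ≤ A) (hδ : 0 ≤ δ) (hres : 0 ≤ κ / 2 - δ / 2 * ((D : ℝ) ^ 2 * Real.sqrt d))
    (k : ℕ) {x₂ y₂ : ℝ} (h : x₂ ≤ y₂) :
    2 ^ (k + 1) * (2 ^ ((k + 1) * D) * 2 ^ 2 ^ ((k + 1) * D) * (max 1 (freeCov d α β 0 0)) ^ ((k + 1) * D)) * (x₂ * (A * Real.exp (δ / 2 * ((D : ℝ) ^ 2 * d)) * Real.exp (-((κ / 2 - δ / 2 * ((D : ℝ) ^ 2 * Real.sqrt d)) / 2 * v)) * (L : ℝ) ^ d * ∑ p ∈ Finset.Icc 1 s, ((admissible p D).card : ℝ) * ((2 / (1 - Real.exp (-((κ / 2 - δ / 2 * ((D : ℝ) ^ 2 * Real.sqrt d)) / 2 / (p : ℕ) / Real.sqrt d)))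 * Real.exp ((κ / 2 - δ / 2 * ((D : ℝ) ^ 2 * Real.sqrt d)) / 2 / (p : ℕ) / Real.sqrt d)) ^ d) ^ (p - 1))) * (A * Real.exp (δ / 2 * ((D : ℝ) ^ 2 * d)) * (2 / (1 - Real.exp (-(δ / (2 * ((k + 1 : ℕ) : ℝ)) / Real.sqrt d))) * Real.exp (δ / (2 * ((k + 1 : ℕ) : ℝ)) / Real.sqrt d)) ^ d * ∑ p ∈ Finset.Icc 1 s, ((admissible p D).card : ℝ) * ((2 / (1 - Real.exp (-((κ / 2 - δ / 2 * ((D : ℝ) ^ 2 * Real.sqrt d)) / (p : ℕ) / Real.sqrt d))) * Real.exp ((κ / 2 - δ / 2 * ((D : ℝ) ^ 2 * Real.sqrt d)) / (p : ℕ) / Real.sqrt d)) ^ d) ^ (p - 1)) ^ k ≤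
    2 ^ (k + 1) * (2 ^ ((k + 1) * D) * 2 ^ 2 ^ ((k + 1) * D) * (max 1 (freeCov d α β 0 0)) ^ ((k + 1) * D)) * (y₂ * (A * Real.exp (δ / 2 * ((D : ℝ) ^ 2 * d)) * Real.exp (-((κ / 2 - δ / 2 * ((D : ℝ) ^ 2 * Real.sqrt d)) / 2 * v)) * (L : ℝ) ^ d * ∑ p ∈ Finset.Icc 1 s, ((admissible p D).card : ℝ) * ((2 / (1 - Real.exp (-((κ / 2 - δ / 2 * ((D : ℝ) ^ 2 * Real.sqrt d)) / 2 / (p : ℕ) / Real.sqrt d))) * Real.exp ((κ / 2 - δ / 2 * ((D : ℝ) ^ 2 * Real.sqrt d)) / 2 / (p : ℕ) / Real.sqrt d)) ^ d) ^ (p - 1))) * (A * Real.exp (δ / 2 * ((D : ℝ) ^ 2 * d)) * (2 / (1 - Real.exp (-(δ / (2 * ((k + 1 : ℕ) : ℝ)) / Real.sqrt d))) * Real.exp (δ / (2 * ((k + 1 : ℕ) : ℝ)) / Real.sqrt d)) ^ d * ∑ p ∈ Finset.Icc 1 s, ((admissible p D).card : ℝ) * ((2 / (1 - Real.exp (-((κ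 / 2 - δ / 2 * ((D : ℝ) ^ 2 * Real.sqrt d)) / (p : ℕ) / Real.sqrt d))) * Real.exp ((κ / 2 - δ / 2 * ((D : ℝ) ^ 2 * Real.sqrt d)) / (p : ℕ) / Real.sqrt d)) ^ d) ^ (p - 1)) ^ k := by
  have hM2 := latticeSumConst_nonneg (s := s) (D := D) (d := d) (c := κ / 2 - δ / 2 * ((D : ℝ) ^ 2 * Real.sqrt d)) hres
  have hM3 := latticeSumConst_nonneg (s := s) (D := D) (d := d) (c := (κ / 2 - δ / 2 * ((D : ℝ) ^ 2 * Real.sqrt d)) / 2) (by linarith)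
  have hg1 : 0 ≤ 2 / (1 - Real.exp (-(δ / (2 * ((k + 1 : ℕ) : ℝ)) / Real.sqrt d))) * Real.exp (δ / (2 * ((k + 1 : ℕ) : ℝ)) / Real.sqrt d) :=
    geom_nonneg (by positivity)
  have hg2 : 0 ≤ 2 / (1 - Real.exp (-(δ / (2 * ((k + 1 : ℕ) : ℝ)) / 2 / Real.sqrt d))) * Real.exp (δ / (2 * ((k + 1 : ℕ) : ℝ)) / 2 / Real.sqrt d) :=
    geom_nonneg (by positivity)
  gcongr

/-- One piece of the closed cumulant-side error (order-`k+1` term), monotone in the cardinality `x₃` — bookkeeping for `cumb_le`.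
[cite: BenfattoEtAl1978, (5.34) p.159 (remainder on Γ̄₁)] -/
theorem cumbRem_le {α β : ℝ} {s D : ℕ} {κ δ A : ℝ} {w : ℕ} (hA : 0 ≤ A) (hδ : 0 ≤ δ) (hres : 0 ≤ κ / 2 - δ / 2 * ((D : ℝ) ^ 2 * Real.sqrt d))
    (k : ℕ) {x₃ y₃ : ℝ} (h : x₃ ≤ y₃) :
    2 ^ (k + 1) * (2 ^ ((k + 1) * D) * 2 ^ 2 ^ ((k + 1) * D) * (max 1 (freeCov d α β 0 0)) ^ ((k + 1) * D)) * (A * Real.exp (δ / 2 * ((D : ℝ) ^ 2 * d)) * Real.exp (-((κ / 2 - δ / 2 * ((D : ℝ) ^ 2 * Real.sqrt d)) / 2 * w)) * x₃ * ∑ p ∈ Finset.Icc 1 s, ((admissible p D).card : ℝ) * ((2 / (1 - Real.exp (-((κ / 2 - δ / 2 * ((D : ℝ) ^ 2 * Real.sqrt d)) / 2 / (p : ℕ) / Real.sqrt d))) * Real.exp ((κ / 2 - δ / 2 * ((D : ℝ) ^ 2 * Real.sqrt d)) / 2 / (p : ℕ) / Real.sqrt d)) ^ d) ^ (p - 1))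 * (A * Real.exp (δ / 2 * ((D : ℝ) ^ 2 * d)) * (2 / (1 - Real.exp (-(δ / (2 * ((k + 1 : ℕ) : ℝ)) / Real.sqrt d))) * Real.exp (δ / (2 * ((k + 1 : ℕ) : ℝ)) / Real.sqrt d)) ^ d * ∑ p ∈ Finset.Icc 1 s, ((admissible p D).card : ℝ) * ((2 / (1 - Real.exp (-((κ / 2 - δ / 2 * ((D : ℝ) ^ 2 * Real.sqrt d)) / (p : ℕ) / Real.sqrt d))) * Real.exp ((κ / 2 - δ / 2 * ((D : ℝ) ^ 2 * Real.sqrt d)) / (p : ℕ) / Real.sqrt d)) ^ d) ^ (p - 1)) ^ k ≤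
    2 ^ (k + 1) * (2 ^ ((k + 1) * D) * 2 ^ 2 ^ ((k + 1) * D) * (max 1 (freeCov d α β 0 0)) ^ ((k + 1) * D)) * (A * Real.exp (δ / 2 * ((D : ℝ) ^ 2 * d)) * Real.exp (-((κ / 2 - δ / 2 * ((D : ℝ) ^ 2 * Real.sqrt d)) / 2 * w)) * y₃ * ∑ p ∈ Finset.Icc 1 s, ((admissible p D).card : ℝ) * ((2 / (1 - Real.exp (-((κ / 2 - δ / 2 * ((D : ℝ) ^ 2 * Real.sqrt d)) / 2 / (p : ℕ) / Real.sqrt d))) * Real.exp ((κ / 2 - δ / 2 * ((D : ℝ) ^ 2 * Real.sqrt d)) / 2 / (p : ℕ) / Real.sqrt d)) ^ d) ^ (p - 1)) * (A * Real.exp (δ / 2 * ((D : ℝ) ^ 2 * d)) * (2 / (1 - Real.exp (-(δ / (2 * ((k + 1 : ℕ) : ℝ)) / Real.sqrt d))) * Real.exp (δ / (2 * ((k + 1 : ℕ) : ℝ)) / Real.sqrt d)) ^ d * ∑ p ∈ Finset.Icc 1 s, ((admissible p D).card : ℝ) * ((2 / (1 - Real.exp (-((κ / 2 - δ / 2 *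 ((D : ℝ) ^ 2 * Real.sqrt d)) / (p : ℕ) / Real.sqrt d))) * Real.exp ((κ / 2 - δ / 2 * ((D : ℝ) ^ 2 * Real.sqrt d)) / (p : ℕ) / Real.sqrt d)) ^ d) ^ (p - 1)) ^ k := by
  have hM2 := latticeSumConst_nonneg (s := s) (D := D) (d := d) (c := κ / 2 - δ / 2 * ((D : ℝ) ^ 2 * Real.sqrt d)) hres
  have hM3 := latticeSumConst_nonneg (s := s) (D := D) (d := d) (c := (κ / 2 - δ / 2 * ((D : ℝ) ^ 2 * Real.sqrt d)) / 2) (by linarith)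
  have hg1 : 0 ≤ 2 / (1 - Real.exp (-(δ / (2 * ((k + 1 : ℕ) : ℝ)) / Real.sqrt d))) * Real.exp (δ / (2 * ((k + 1 : ℕ) : ℝ)) / Real.sqrt d) :=
    geom_nonneg (by positivity)
  have hg2 : 0 ≤ 2 / (1 - Real.exp (-(δ / (2 * ((k + 1 : ℕ) : ℝ)) / 2 / Real.sqrt d))) * Real.exp (δ / (2 * ((k + 1 : ℕ) : ℝ)) / 2 / Real.sqrt d) :=
    geom_nonneg (by positivity)
  gcongr

/-- One piece of the closed cumulant-side error (order-`k+1` term), monotone in the cardinality `x₂` — bookkeeping for `cumb_le`.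
[cite: BenfattoEtAl1978, (5.34) p.159 (inter-box correlations)] -/
theorem cumbCorr_le {α β : ℝ} {s D : ℕ} {κ δ A : ℝ} {L v : ℕ} (hA : 0 ≤ A) (hδ : 0 ≤ δ) (hres : 0 ≤ κ / 2 - δ / 2 * ((D : ℝ) ^ 2 * Real.sqrt d))
    (k : ℕ) {x₂ y₂ : ℝ} (h : x₂ ≤ y₂) :
    2 ^ (k + 1) * (2 ^ ((k + 1) * D) * 2 ^ 2 ^ ((k + 1) * D) * (max 1 (freeCov d α β 0 0)) ^ ((k + 1) * D)) * (x₂ * (A * Real.exp (δ / 2 * ((D : ℝ) ^ 2 * d)) * Real.exp (-((κ / 2 - δ / 2 * ((D : ℝ) ^ 2 * Real.sqrt d)) / 2 * v)) * (L : ℝ) ^ d * ∑ p ∈ Finset.Icc 1 s, ((admissible p D).card : ℝ) * ((2 / (1 - Real.exp (-((κ / 2 - δ / 2 * ((D : ℝ) ^ 2 * Real.sqrt d)) / 2 / (p : ℕ) / Real.sqrt d))) * Real.exp ((κ / 2 - δ / 2 * ((D : ℝ) ^ 2 * Real.sqrt d)) / 2 / (p : ℕ) / Real.sqrt d)) ^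 d) ^ (p - 1))) * (A * Real.exp (δ / 2 * ((D : ℝ) ^ 2 * d)) * (2 / (1 - Real.exp (-(δ / (2 * ((k + 1 : ℕ) : ℝ)) / Real.sqrt d))) * Real.exp (δ / (2 * ((k + 1 : ℕ) : ℝ)) / Real.sqrt d)) ^ d * ∑ p ∈ Finset.Icc 1 s, ((admissible p D).card : ℝ) * ((2 / (1 - Real.exp (-((κ / 2 - δ / 2 * ((D : ℝ) ^ 2 * Real.sqrt d)) / (p : ℕ) / Real.sqrt d))) * Real.exp ((κ / 2 - δ / 2 * ((D : ℝ) ^ 2 * Real.sqrt d)) / (p : ℕ) / Real.sqrt d)) ^ d) ^ (p - 1)) ^ k ≤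
    2 ^ (k + 1) * (2 ^ ((k + 1) * D) * 2 ^ 2 ^ ((k + 1) * D) * (max 1 (freeCov d α β 0 0)) ^ ((k + 1) * D)) * (y₂ * (A * Real.exp (δ / 2 * ((D : ℝ) ^ 2 * d)) * Real.exp (-((κ / 2 - δ / 2 * ((D : ℝ) ^ 2 * Real.sqrt d)) / 2 * v)) * (L : ℝ) ^ d * ∑ p ∈ Finset.Icc 1 s, ((admissible p D).card : ℝ) * ((2 / (1 - Real.exp (-((κ / 2 - δ / 2 * ((D : ℝ) ^ 2 * Real.sqrt d)) / 2 / (p : ℕ) / Real.sqrt d))) * Real.exp ((κ / 2 - δ / 2 * ((D : ℝ) ^ 2 * Real.sqrt d)) / 2 / (p : ℕ) / Real.sqrt d)) ^ d) ^ (p - 1))) * (A * Real.exp (δ / 2 * ((D : ℝ) ^ 2 * d)) * (2 / (1 - Real.exp (-(δ / (2 * ((k + 1 : ℕ) : ℝ)) / Real.sqrt d))) * Real.exp (δ / (2 * ((k + 1 : ℕ) : ℝ)) / Real.sqrt d)) ^ d * ∑ p ∈ Finset.Icc 1 s, ((admissible p D).card : ℝ) * ((2 / (1 - Real.exp (-((κ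 / 2 - δ / 2 * ((D : ℝ) ^ 2 * Real.sqrt d)) / (p : ℕ) / Real.sqrt d))) * Real.exp ((κ / 2 - δ / 2 * ((D : ℝ) ^ 2 * Real.sqrt d)) / (p : ℕ) / Real.sqrt d)) ^ d) ^ (p - 1)) ^ k := by
  have hM2 := latticeSumConst_nonneg (s := s) (D := D) (d := d) (c := κ / 2 - δ / 2 * ((D : ℝ) ^ 2 * Real.sqrt d)) hres
  have hM3 := latticeSumConst_nonneg (s := s) (D := D) (d := d) (c := (κ / 2 - δ / 2 * ((D : ℝ) ^ 2 * Real.sqrt d)) / 2) (by linarith)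
  have hg1 : 0 ≤ 2 / (1 - Real.exp (-(δ / (2 * ((k + 1 : ℕ) : ℝ)) / Real.sqrt d))) * Real.exp (δ / (2 * ((k + 1 : ℕ) : ℝ)) / Real.sqrt d) :=
    geom_nonneg (by positivity)
  have hg2 : 0 ≤ 2 / (1 - Real.exp (-(δ / (2 * ((k + 1 : ℕ) : ℝ)) / 2 / Real.sqrt d))) * Real.exp (δ / (2 * ((k + 1 : ℕ) : ℝ)) / 2 / Real.sqrt d) :=
    geom_nonneg (by positivity)
  gcongr

/-- One piece of the closed cumulant-side error (order-`k+1` term), monotone in the cardinality `x₂` — bookkeeping for `cumb_le`.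
[cite: BenfattoEtAl1978, (5.29)–(5.31) p.157–158 (cross terms)] -/
theorem cumbCross_le {α β : ℝ} {s D : ℕ} {κ δ A : ℝ} {L w v : ℕ} (hA : 0 ≤ A) (hδ : 0 ≤ δ) (hres : 0 ≤ κ / 2 - δ / 2 * ((D : ℝ) ^ 2 * Real.sqrt d))
    (k : ℕ) {x₂ y₂ : ℝ} (h : x₂ ≤ y₂) :
    2 ^ ((k + 1) * D) * 2 ^ 2 ^ ((k + 1) * D) * (max 1 (freeCov d α β 0 0)) ^ ((k + 1) * D) * (x₂ * (((k + 1 : ℕ) : ℝ) * (k : ℝ) * ((A * Real.exp (δ / 2 * ((D : ℝ) ^ 2 * d)) * ((L : ℝ) ^ d * (2 / (1 - Real.exp (-(δ / (2 * ((k + 1 : ℕ) : ℝ)) / Real.sqrt d))) * Real.exp (δ / (2 * ((k + 1 : ℕ) : ℝ)) / Real.sqrt d)) ^ d) * ∑ p ∈ Finset.Icc 1 s, ((admissible p D).card : ℝ) * ((2 / (1 - Real.exp (-((κ / 2 - δ / 2 * ((D : ℝ) ^ 2 * Real.sqrt d)) / (p : ℕ) / Real.sqrt d))) * Real.exp ((κ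 / 2 - δ / 2 * ((D : ℝ) ^ 2 * Real.sqrt d)) / (p : ℕ) / Real.sqrt d)) ^ d) ^ (p - 1)) * ((A * Real.exp (δ / 2 * ((D : ℝ) ^ 2 * d)) * Real.exp (-(δ / (2 * ((k + 1 : ℕ) : ℝ)) / 2 * ((w : ℝ) + v + 1))) * ((L : ℝ) ^ d * (2 / (1 - Real.exp (-(δ / (2 * ((k + 1 : ℕ) : ℝ)) / 2 / Real.sqrt d))) * Real.exp (δ / (2 * ((k + 1 : ℕ) : ℝ)) / 2 / Real.sqrt d)) ^ d) * ∑ p ∈ Finset.Icc 1 s, ((admissible p D).card : ℝ) * ((2 / (1 - Real.exp (-((κ / 2 - δ / 2 * ((D : ℝ) ^ 2 * Real.sqrt d)) / (p : ℕ) / Real.sqrt d))) * Real.exp ((κ / 2 - δ / 2 * ((D : ℝ) ^ 2 * Real.sqrt d)) / (p : ℕ) / Real.sqrt d)) ^ d) ^ (p - 1)) * (A * Real.exp (δ / 2 * ((D : ℝ) ^ 2 * d)) * ((L : ℝ) ^ d * (2 / (1 - Real.exp (-(δ / (2 * ((k + 1 : ℕ) : ℝ)) / Real.sqrt d))) * Real.exp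 (δ / (2 * ((k + 1 : ℕ) : ℝ)) / Real.sqrt d)) ^ d) * ∑ p ∈ Finset.Icc 1 s, ((admissible p D).card : ℝ) * ((2 / (1 - Real.exp (-((κ / 2 - δ / 2 * ((D : ℝ) ^ 2 * Real.sqrt d)) / (p : ℕ) / Real.sqrt d))) * Real.exp ((κ / 2 - δ / 2 * ((D : ℝ) ^ 2 * Real.sqrt d)) / (p : ℕ) / Real.sqrt d)) ^ d) ^ (p - 1)) ^ (k - 1))))) ≤
    2 ^ ((k + 1) * D) * 2 ^ 2 ^ ((k + 1) * D) * (max 1 (freeCov d α β 0 0)) ^ ((k + 1) * D) * (y₂ * (((k + 1 : ℕ) : ℝ) * (k : ℝ) * ((A * Real.exp (δ / 2 * ((D : ℝ) ^ 2 * d)) * ((L : ℝ) ^ d * (2 / (1 - Real.exp (-(δ / (2 * ((k + 1 : ℕ) : ℝ)) / Real.sqrt d))) * Real.exp (δ / (2 * ((k + 1 : ℕ) : ℝ)) / Real.sqrt d)) ^ d) * ∑ p ∈ Finset.Icc 1 s, ((admissible p D).card : ℝ) * ((2 / (1 - Real.exp (-((κ / 2 - δ / 2 * ((D : ℝ) ^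 2 * Real.sqrt d)) / (p : ℕ) / Real.sqrt d))) * Real.exp ((κ / 2 - δ / 2 * ((D : ℝ) ^ 2 * Real.sqrt d)) / (p : ℕ) / Real.sqrt d)) ^ d) ^ (p - 1)) * ((A * Real.exp (δ / 2 * ((D : ℝ) ^ 2 * d)) * Real.exp (-(δ / (2 * ((k + 1 : ℕ) : ℝ)) / 2 * ((w : ℝ) + v + 1))) * ((L : ℝ) ^ d * (2 / (1 - Real.exp (-(δ / (2 * ((k + 1 : ℕ) : ℝ)) / 2 / Real.sqrt d))) * Real.exp (δ / (2 * ((k + 1 : ℕ) : ℝ)) / 2 / Real.sqrt d)) ^ d) * ∑ p ∈ Finset.Icc 1 s, ((admissible p D).card : ℝ) * ((2 / (1 - Real.exp (-((κ / 2 - δ / 2 * ((D : ℝ) ^ 2 * Real.sqrt d)) / (p : ℕ) / Real.sqrt d))) * Real.exp ((κ / 2 - δ / 2 * ((D : ℝ) ^ 2 * Real.sqrt d)) / (p : ℕ) / Real.sqrt d)) ^ d) ^ (p - 1)) * (A * Real.exp (δ / 2 * ((D : ℝ) ^ 2 * d)) * ((L : ℝ) ^ d * (2 / (1 - Real.exp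 (-(δ / (2 * ((k + 1 : ℕ) : ℝ)) / Real.sqrt d))) * Real.exp (δ / (2 * ((k + 1 : ℕ) : ℝ)) / Real.sqrt d)) ^ d) * ∑ p ∈ Finset.Icc 1 s, ((admissible p D).card : ℝ) * ((2 / (1 - Real.exp (-((κ / 2 - δ / 2 * ((D : ℝ) ^ 2 * Real.sqrt d)) / (p : ℕ) / Real.sqrt d))) * Real.exp ((κ / 2 - δ / 2 * ((D : ℝ) ^ 2 * Real.sqrt d)) / (p : ℕ) / Real.sqrt d)) ^ d) ^ (p - 1)) ^ (k - 1))))) := by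
  have hM2 := latticeSumConst_nonneg (s := s) (D := D) (d := d) (c := κ / 2 - δ / 2 * ((D : ℝ) ^ 2 * Real.sqrt d)) hres
  have hM3 := latticeSumConst_nonneg (s := s) (D := D) (d := d) (c := (κ / 2 - δ / 2 * ((D : ℝ) ^ 2 * Real.sqrt d)) / 2) (by linarith)
  have hg1 : 0 ≤ 2 / (1 - Real.exp (-(δ / (2 * ((k + 1 : ℕ) : ℝ)) / Real.sqrt d))) * Real.exp (δ / (2 * ((k + 1 : ℕ) : ℝ)) / Real.sqrt d) :=
    geom_nonneg (by positivity)
  have hg2 : 0 ≤ 2 / (1 - Real.exp (-(δ / (2 * ((k + 1 : ℕ) : ℝ)) / 2 / Real.sqrt d))) * Real.exp (δ / (2 * ((k + 1 : ℕ) : ℝ)) / 2 / Real.sqrt d) :=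
    geom_nonneg (by positivity)
  gcongr

/-- One piece of the closed cumulant-side error (order-`k+1` term), monotone in the cardinality `x₂` — bookkeeping for `cumb_le`.
[cite: BenfattoEtAl1978, (5.29) p.157] -/
theorem cumbW29_le {α β : ℝ} {s D : ℕ} {κ δ A : ℝ} {L v : ℕ} (hA : 0 ≤ A) (hδ : 0 ≤ δ) (hres : 0 ≤ κ / 2 - δ / 2 * ((D : ℝ) ^ 2 * Real.sqrt d))
    (k : ℕ) {x₂ y₂ : ℝ} (h : x₂ ≤ y₂) :
    x₂ * ((3 : ℝ) ^ (k + 1) * (2 ^ ((k + 1) * D) * 2 ^ 2 ^ ((k + 1) * D) * (max 1 (freeCov d α β 0 0)) ^ ((k + 1) * D) * Real.exp (-(δ / 2 * ((v : ℝ) + 1))) * (A * Real.exp (δ / 2 * ((D : ℝ) ^ 2 * d)) * (L : ℝ) ^ d * ∑ p ∈ Finset.Icc 1 s, ((admissible p D).card : ℝ) * ((2 / (1 - Real.exp (-((κ / 2 - δ / 2 * ((D : ℝ) ^ 2 * Real.sqrt d)) / (p : ℕ) / Real.sqrt d))) * Real.exp ((κ / 2 - δ / 2 * ((D : ℝ)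 ^ 2 * Real.sqrt d)) / (p : ℕ) / Real.sqrt d)) ^ d) ^ (p - 1)) ^ (k + 1))) ≤
    y₂ * ((3 : ℝ) ^ (k + 1) * (2 ^ ((k + 1) * D) * 2 ^ 2 ^ ((k + 1) * D) * (max 1 (freeCov d α β 0 0)) ^ ((k + 1) * D) * Real.exp (-(δ / 2 * ((v : ℝ) + 1))) * (A * Real.exp (δ / 2 * ((D : ℝ) ^ 2 * d)) * (L : ℝ) ^ d * ∑ p ∈ Finset.Icc 1 s, ((admissible p D).card : ℝ) * ((2 / (1 - Real.exp (-((κ / 2 - δ / 2 * ((D : ℝ) ^ 2 * Real.sqrt d)) / (p : ℕ) / Real.sqrt d))) * Real.exp ((κ / 2 - δ / 2 * ((D : ℝ) ^ 2 * Real.sqrt d)) / (p : ℕ) / Real.sqrt d)) ^ d) ^ (p - 1)) ^ (k + 1))) := by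
  have hM2 := latticeSumConst_nonneg (s := s) (D := D) (d := d) (c := κ / 2 - δ / 2 * ((D : ℝ) ^ 2 * Real.sqrt d)) hres
  have hM3 := latticeSumConst_nonneg (s := s) (D := D) (d := d) (c := (κ / 2 - δ / 2 * ((D : ℝ) ^ 2 * Real.sqrt d)) / 2) (by linarith)
  have hg1 : 0 ≤ 2 / (1 - Real.exp (-(δ / (2 * ((k + 1 : ℕ) : ℝ)) / Real.sqrt d))) * Real.exp (δ / (2 * ((k + 1 : ℕ) : ℝ)) / Real.sqrt d) :=
    geom_nonneg (by positivity)
  have hg2 : 0 ≤ 2 / (1 - Real.exp (-(δ / (2 * ((k + 1 : ℕ) : ℝ)) / 2 / Real.sqrt d))) * Real.exp (δ / (2 * ((k + 1 : ℕ) : ℝ)) / 2 / Real.sqrt d) :=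
    geom_nonneg (by positivity)
  gcongr

set_option maxHeartbeats 800000 in -- two copies of the closed cumulant-side error in one statement
/-- **The closed cumulant-side error is monotone in the cardinalities**: the bound `CUMB(|J|, |B|, |Γ̄₁(B)|)` of `…StepBound.cumulantSide_le` ∕
`exists_lower_step` (arguments `x₁ = |J|`, `x₂ = |B|`, `x₃ = |Γ̄₁(B)|`) increases with each of them (all co-factors are non-negative).
[cite: BenfattoEtAl1978, (5.11) p.155, (5.29)–(5.31) p.157–158, (5.34) p.159, p.159] -/
theorem cumb_le {α β : ℝ} {s D : ℕ} {κ δ A : ℝ} {L w v t : ℕ} (hA : 0 ≤ A) (hδ : 0 ≤ δ) (hres : 0 ≤ κ / 2 - δ / 2 * ((D : ℝ) ^ 2 * Real.sqrt d))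
    {x₁ x₂ x₃ y₁ y₂ y₃ : ℝ} (h₁ : x₁ ≤ y₁) (h₂ : x₂ ≤ y₂) (h₃ : x₃ ≤ y₃) :
    ((            ∑ k ∈ Finset.range t,
          ((2 ^ (k + 1) * (2 ^ ((k + 1) * D) * 2 ^ 2 ^ ((k + 1) * D) * (max 1 (freeCov d α β 0 0)) ^ ((k + 1) * D)) *
          ((A * Real.exp (δ / 2 * ((D : ℝ) ^ 2 * d)) *
              Real.exp (-((κ / 2 - δ / 2 * ((D : ℝ) ^ 2 * Real.sqrt d)) / 2 * w))) * x₁ *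
            ∑ p ∈ Finset.Icc 1 s, ((admissible p D).card : ℝ) *
              ((2 / (1 - Real.exp (-((κ / 2 - δ / 2 * ((D : ℝ) ^ 2 * Real.sqrt d)) / 2 / (p : ℕ) / Real.sqrt d))) *
                Real.exp ((κ / 2 - δ / 2 * ((D : ℝ) ^ 2 * Real.sqrt d)) / 2 / (p : ℕ) / Real.sqrt d)) ^ d) ^ (p - 1)) *
          (A * Real.exp (δ / 2 * ((D : ℝ) ^ 2 * d)) *
            ((1 : ℝ) * (2 / (1 - Real.exp (-(δ / (2 * ((k + 1 : ℕ) : ℝ)) / Real.sqrt d))) * Real.exp (δ / (2 * ((k + 1 : ℕ) : ℝ)) / Real.sqrt d)) ^ d) *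
            ∑ p ∈ Finset.Icc 1 s, ((admissible p D).card : ℝ) *
              ((2 / (1 - Real.exp (-((κ / 2 - δ / 2 * ((D : ℝ) ^ 2 * Real.sqrt d)) / (p : ℕ) / Real.sqrt d))) *
                Real.exp ((κ / 2 - δ / 2 * ((D : ℝ) ^ 2 * Real.sqrt d)) / (p : ℕ) / Real.sqrt d)) ^ d) ^ (p - 1)) ^ k
          + 2 ^ (k + 1) * (2 ^ ((k + 1) * D) * 2 ^ 2 ^ ((k + 1) * D) * (max 1 (freeCov d α β 0 0)) ^ ((k + 1) * D)) *
        (x₂ * (A * Real.exp (δ / 2 * ((D : ℝ) ^ 2 * d)) * Real.exp (-((κ / 2 - δ / 2 * ((D : ℝ) ^ 2 * Real.sqrt d)) / 2 * v)) *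
          (L : ℝ) ^ d * ∑ p ∈ Finset.Icc 1 s, ((admissible p D).card : ℝ) *
              ((2 / (1 - Real.exp (-((κ / 2 - δ / 2 * ((D : ℝ) ^ 2 * Real.sqrt d)) / 2 / (p : ℕ) / Real.sqrt d))) *
                Real.exp ((κ / 2 - δ / 2 * ((D : ℝ) ^ 2 * Real.sqrt d)) / 2 / (p : ℕ) / Real.sqrt d)) ^ d) ^ (p - 1))) *
        (A * Real.exp (δ / 2 * ((D : ℝ) ^ 2 * d)) *
          (2 / (1 - Real.exp (-(δ / (2 * ((k + 1 : ℕ) : ℝ)) / Real.sqrt d))) * Real.exp (δ / (2 * ((k + 1 : ℕ) : ℝ)) / Real.sqrt d)) ^ d *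
          ∑ p ∈ Finset.Icc 1 s, ((admissible p D).card : ℝ) *
              ((2 / (1 - Real.exp (-((κ / 2 - δ / 2 * ((D : ℝ) ^ 2 * Real.sqrt d)) / (p : ℕ) / Real.sqrt d))) *
                Real.exp ((κ / 2 - δ / 2 * ((D : ℝ) ^ 2 * Real.sqrt d)) / (p : ℕ) / Real.sqrt d)) ^ d) ^ (p - 1)) ^ k)
          + (2 ^ (k + 1) * (2 ^ ((k + 1) * D) * 2 ^ 2 ^ ((k + 1) * D) * (max 1 (freeCov d α β 0 0)) ^ ((k + 1) * D)) *
          (A * Real.exp (δ / 2 * ((D : ℝ) ^ 2 * d)) * Real.exp (-((κ / 2 - δ / 2 * ((D : ℝ) ^ 2 * Real.sqrt d)) / 2 * w)) *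
            x₃ * ∑ p ∈ Finset.Icc 1 s, ((admissible p D).card : ℝ) *
              ((2 / (1 - Real.exp (-((κ / 2 - δ / 2 * ((D : ℝ) ^ 2 * Real.sqrt d)) / 2 / (p : ℕ) / Real.sqrt d))) *
                Real.exp ((κ / 2 - δ / 2 * ((D : ℝ) ^ 2 * Real.sqrt d)) / 2 / (p : ℕ) / Real.sqrt d)) ^ d) ^ (p - 1)) *
          (A * Real.exp (δ / 2 * ((D : ℝ) ^ 2 * d)) *
            (2 / (1 - Real.exp (-(δ / (2 * ((k + 1 : ℕ) : ℝ)) / Real.sqrt d))) * Real.exp (δ / (2 * ((k + 1 : ℕ) : ℝ)) / Real.sqrt d)) ^ d *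
            ∑ p ∈ Finset.Icc 1 s, ((admissible p D).card : ℝ) *
              ((2 / (1 - Real.exp (-((κ / 2 - δ / 2 * ((D : ℝ) ^ 2 * Real.sqrt d)) / (p : ℕ) / Real.sqrt d))) *
                Real.exp ((κ / 2 - δ / 2 * ((D : ℝ) ^ 2 * Real.sqrt d)) / (p : ℕ) / Real.sqrt d)) ^ d) ^ (p - 1)) ^ k
          + 2 ^ (k + 1) * (2 ^ ((k + 1) * D) * 2 ^ 2 ^ ((k + 1) * D) * (max 1 (freeCov d α β 0 0)) ^ ((k + 1) * D)) *
        (x₂ * (A * Real.exp (δ / 2 * ((D : ℝ) ^ 2 * d)) * Real.exp (-((κ / 2 - δ / 2 * ((D : ℝ) ^ 2 * Real.sqrt d)) / 2 * v)) *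
          (L : ℝ) ^ d * ∑ p ∈ Finset.Icc 1 s, ((admissible p D).card : ℝ) *
              ((2 / (1 - Real.exp (-((κ / 2 - δ / 2 * ((D : ℝ) ^ 2 * Real.sqrt d)) / 2 / (p : ℕ) / Real.sqrt d))) *
                Real.exp ((κ / 2 - δ / 2 * ((D : ℝ) ^ 2 * Real.sqrt d)) / 2 / (p : ℕ) / Real.sqrt d)) ^ d) ^ (p - 1))) *
        (A * Real.exp (δ / 2 * ((D : ℝ) ^ 2 * d)) *
          (2 / (1 - Real.exp (-(δ / (2 * ((k + 1 : ℕ) : ℝ)) / Real.sqrt d))) * Real.exp (δ / (2 * ((k + 1 : ℕ) : ℝ)) / Real.sqrt d)) ^ d *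
          ∑ p ∈ Finset.Icc 1 s, ((admissible p D).card : ℝ) *
              ((2 / (1 - Real.exp (-((κ / 2 - δ / 2 * ((D : ℝ) ^ 2 * Real.sqrt d)) / (p : ℕ) / Real.sqrt d))) *
                Real.exp ((κ / 2 - δ / 2 * ((D : ℝ) ^ 2 * Real.sqrt d)) / (p : ℕ) / Real.sqrt d)) ^ d) ^ (p - 1)) ^ k)
          + 2 ^ ((k + 1) * D) * 2 ^ 2 ^ ((k + 1) * D) * (max 1 (freeCov d α β 0 0)) ^ ((k + 1) * D) *
        (x₂ * (((k + 1 : ℕ) : ℝ) * (k : ℝ) *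
          ((A * Real.exp (δ / 2 * ((D : ℝ) ^ 2 * d)) * ((L : ℝ) ^ d * (2 / (1 - Real.exp (-(δ / (2 * ((k + 1 : ℕ) : ℝ)) / Real.sqrt d))) * Real.exp (δ / (2 * ((k + 1 : ℕ) : ℝ)) / Real.sqrt d)) ^ d) *
              ∑ p ∈ Finset.Icc 1 s, ((admissible p D).card : ℝ) *
              ((2 / (1 - Real.exp (-((κ / 2 - δ / 2 * ((D : ℝ) ^ 2 * Real.sqrt d)) / (p : ℕ) / Real.sqrt d))) *
                Real.exp ((κ / 2 - δ / 2 * ((D : ℝ) ^ 2 * Real.sqrt d)) / (p : ℕ) / Real.sqrt d)) ^ d) ^ (p - 1)) * ((A * Real.exp (δ / 2 * ((D : ℝ) ^ 2 * d)) * Real.exp (-(δ / (2 * ((k + 1 : ℕ) : ℝ)) / 2 * ((w : ℝ) + v + 1))) * ((L : ℝ) ^ d * (2 / (1 - Real.exp (-(δ / (2 * ((k + 1 : ℕ) : ℝ)) / 2 / Real.sqrt d))) * Real.exp (δ / (2 * ((k + 1 : ℕ) : ℝ)) / 2 / Real.sqrt d)) ^ d) *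
              ∑ p ∈ Finset.Icc 1 s, ((admissible p D).card : ℝ) *
              ((2 / (1 - Real.exp (-((κ / 2 - δ / 2 * ((D : ℝ) ^ 2 * Real.sqrt d)) / (p : ℕ) / Real.sqrt d))) *
                Real.exp ((κ / 2 - δ / 2 * ((D : ℝ) ^ 2 * Real.sqrt d)) / (p : ℕ) / Real.sqrt d)) ^ d) ^ (p - 1)) *
             (A * Real.exp (δ / 2 * ((D : ℝ) ^ 2 * d)) * ((L : ℝ) ^ d * (2 / (1 - Real.exp (-(δ / (2 * ((k + 1 : ℕ) : ℝ)) / Real.sqrt d))) * Real.exp (δ / (2 * ((k + 1 : ℕ) : ℝ)) / Real.sqrt d)) ^ d) *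
              ∑ p ∈ Finset.Icc 1 s, ((admissible p D).card : ℝ) *
              ((2 / (1 - Real.exp (-((κ / 2 - δ / 2 * ((D : ℝ) ^ 2 * Real.sqrt d)) / (p : ℕ) / Real.sqrt d))) *
                Real.exp ((κ / 2 - δ / 2 * ((D : ℝ) ^ 2 * Real.sqrt d)) / (p : ℕ) / Real.sqrt d)) ^ d) ^ (p - 1)) ^ (k - 1)))))
          + x₂ * ((3 : ℝ) ^ (k + 1) *
        (2 ^ ((k + 1) * D) * 2 ^ 2 ^ ((k + 1) * D) * (max 1 (freeCov d α β 0 0)) ^ ((k + 1) * D) *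
            Real.exp (-(δ / 2 * ((v : ℝ) + 1))) *
          (A * Real.exp (δ / 2 * ((D : ℝ) ^ 2 * d)) * (L : ℝ) ^ d * ∑ p ∈ Finset.Icc 1 s, ((admissible p D).card : ℝ) *
              ((2 / (1 - Real.exp (-((κ / 2 - δ / 2 * ((D : ℝ) ^ 2 * Real.sqrt d)) / (p : ℕ) / Real.sqrt d))) *
                Real.exp ((κ / 2 - δ / 2 * ((D : ℝ) ^ 2 * Real.sqrt d)) / (p : ℕ) / Real.sqrt d)) ^ d) ^ (p - 1)) ^ (k + 1)))) / (k + 1)! : ℝ)) ≤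
    ((            ∑ k ∈ Finset.range t,
          ((2 ^ (k + 1) * (2 ^ ((k + 1) * D) * 2 ^ 2 ^ ((k + 1) * D) * (max 1 (freeCov d α β 0 0)) ^ ((k + 1) * D)) *
          ((A * Real.exp (δ / 2 * ((D : ℝ) ^ 2 * d)) *
              Real.exp (-((κ / 2 - δ / 2 * ((D : ℝ) ^ 2 * Real.sqrt d)) / 2 * w))) * y₁ *
            ∑ p ∈ Finset.Icc 1 s, ((admissible p D).card : ℝ) *
              ((2 / (1 - Real.exp (-((κ / 2 - δ / 2 * ((D : ℝ) ^ 2 * Real.sqrt d)) / 2 / (p : ℕ) / Real.sqrt d))) *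
                Real.exp ((κ / 2 - δ / 2 * ((D : ℝ) ^ 2 * Real.sqrt d)) / 2 / (p : ℕ) / Real.sqrt d)) ^ d) ^ (p - 1)) *
          (A * Real.exp (δ / 2 * ((D : ℝ) ^ 2 * d)) *
            ((1 : ℝ) * (2 / (1 - Real.exp (-(δ / (2 * ((k + 1 : ℕ) : ℝ)) / Real.sqrt d))) * Real.exp (δ / (2 * ((k + 1 : ℕ) : ℝ)) / Real.sqrt d)) ^ d) *
            ∑ p ∈ Finset.Icc 1 s, ((admissible p D).card : ℝ) *
              ((2 / (1 - Real.exp (-((κ / 2 - δ / 2 * ((D : ℝ) ^ 2 * Real.sqrt d)) / (p : ℕ) / Real.sqrt d))) *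
                Real.exp ((κ / 2 - δ / 2 * ((D : ℝ) ^ 2 * Real.sqrt d)) / (p : ℕ) / Real.sqrt d)) ^ d) ^ (p - 1)) ^ k
          + 2 ^ (k + 1) * (2 ^ ((k + 1) * D) * 2 ^ 2 ^ ((k + 1) * D) * (max 1 (freeCov d α β 0 0)) ^ ((k + 1) * D)) *
        (y₂ * (A * Real.exp (δ / 2 * ((D : ℝ) ^ 2 * d)) * Real.exp (-((κ / 2 - δ / 2 * ((D : ℝ) ^ 2 * Real.sqrt d)) / 2 * v)) *
          (L : ℝ) ^ d * ∑ p ∈ Finset.Icc 1 s, ((admissible p D).card : ℝ) *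
              ((2 / (1 - Real.exp (-((κ / 2 - δ / 2 * ((D : ℝ) ^ 2 * Real.sqrt d)) / 2 / (p : ℕ) / Real.sqrt d))) *
                Real.exp ((κ / 2 - δ / 2 * ((D : ℝ) ^ 2 * Real.sqrt d)) / 2 / (p : ℕ) / Real.sqrt d)) ^ d) ^ (p - 1))) *
        (A * Real.exp (δ / 2 * ((D : ℝ) ^ 2 * d)) *
          (2 / (1 - Real.exp (-(δ / (2 * ((k + 1 : ℕ) : ℝ)) / Real.sqrt d))) * Real.exp (δ / (2 * ((k + 1 : ℕ) : ℝ)) / Real.sqrt d)) ^ d *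
          ∑ p ∈ Finset.Icc 1 s, ((admissible p D).card : ℝ) *
              ((2 / (1 - Real.exp (-((κ / 2 - δ / 2 * ((D : ℝ) ^ 2 * Real.sqrt d)) / (p : ℕ) / Real.sqrt d))) *
                Real.exp ((κ / 2 - δ / 2 * ((D : ℝ) ^ 2 * Real.sqrt d)) / (p : ℕ) / Real.sqrt d)) ^ d) ^ (p - 1)) ^ k)
          + (2 ^ (k + 1) * (2 ^ ((k + 1) * D) * 2 ^ 2 ^ ((k + 1) * D) * (max 1 (freeCov d α β 0 0)) ^ ((k + 1) * D)) *
          (A * Real.exp (δ / 2 * ((D : ℝ) ^ 2 * d)) * Real.exp (-((κ / 2 - δ / 2 * ((D : ℝ) ^ 2 * Real.sqrt d)) / 2 * w)) *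
            y₃ * ∑ p ∈ Finset.Icc 1 s, ((admissible p D).card : ℝ) *
              ((2 / (1 - Real.exp (-((κ / 2 - δ / 2 * ((D : ℝ) ^ 2 * Real.sqrt d)) / 2 / (p : ℕ) / Real.sqrt d))) *
                Real.exp ((κ / 2 - δ / 2 * ((D : ℝ) ^ 2 * Real.sqrt d)) / 2 / (p : ℕ) / Real.sqrt d)) ^ d) ^ (p - 1)) *
          (A * Real.exp (δ / 2 * ((D : ℝ) ^ 2 * d)) *
            (2 / (1 - Real.exp (-(δ / (2 * ((k + 1 : ℕ) : ℝ)) / Real.sqrt d))) * Real.exp (δ / (2 * ((k + 1 : ℕ) : ℝ)) / Real.sqrt d)) ^ d *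
            ∑ p ∈ Finset.Icc 1 s, ((admissible p D).card : ℝ) *
              ((2 / (1 - Real.exp (-((κ / 2 - δ / 2 * ((D : ℝ) ^ 2 * Real.sqrt d)) / (p : ℕ) / Real.sqrt d))) *
                Real.exp ((κ / 2 - δ / 2 * ((D : ℝ) ^ 2 * Real.sqrt d)) / (p : ℕ) / Real.sqrt d)) ^ d) ^ (p - 1)) ^ k
          + 2 ^ (k + 1) * (2 ^ ((k + 1) * D) * 2 ^ 2 ^ ((k + 1) * D) * (max 1 (freeCov d α β 0 0)) ^ ((k + 1) * D)) *
        (y₂ * (A * Real.exp (δ / 2 * ((D : ℝ) ^ 2 * d)) * Real.exp (-((κ / 2 - δ / 2 * ((D : ℝ) ^ 2 * Real.sqrt d)) / 2 * v)) *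
          (L : ℝ) ^ d * ∑ p ∈ Finset.Icc 1 s, ((admissible p D).card : ℝ) *
              ((2 / (1 - Real.exp (-((κ / 2 - δ / 2 * ((D : ℝ) ^ 2 * Real.sqrt d)) / 2 / (p : ℕ) / Real.sqrt d))) *
                Real.exp ((κ / 2 - δ / 2 * ((D : ℝ) ^ 2 * Real.sqrt d)) / 2 / (p : ℕ) / Real.sqrt d)) ^ d) ^ (p - 1))) *
        (A * Real.exp (δ / 2 * ((D : ℝ) ^ 2 * d)) *
          (2 / (1 - Real.exp (-(δ / (2 * ((k + 1 : ℕ) : ℝ)) / Real.sqrt d))) * Real.exp (δ / (2 * ((k + 1 : ℕ) : ℝ)) / Real.sqrt d)) ^ d *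
          ∑ p ∈ Finset.Icc 1 s, ((admissible p D).card : ℝ) *
              ((2 / (1 - Real.exp (-((κ / 2 - δ / 2 * ((D : ℝ) ^ 2 * Real.sqrt d)) / (p : ℕ) / Real.sqrt d))) *
                Real.exp ((κ / 2 - δ / 2 * ((D : ℝ) ^ 2 * Real.sqrt d)) / (p : ℕ) / Real.sqrt d)) ^ d) ^ (p - 1)) ^ k)
          + 2 ^ ((k + 1) * D) * 2 ^ 2 ^ ((k + 1) * D) * (max 1 (freeCov d α β 0 0)) ^ ((k + 1) * D) *
        (y₂ * (((k + 1 : ℕ) : ℝ) * (k : ℝ) *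
          ((A * Real.exp (δ / 2 * ((D : ℝ) ^ 2 * d)) * ((L : ℝ) ^ d * (2 / (1 - Real.exp (-(δ / (2 * ((k + 1 : ℕ) : ℝ)) / Real.sqrt d))) * Real.exp (δ / (2 * ((k + 1 : ℕ) : ℝ)) / Real.sqrt d)) ^ d) *
              ∑ p ∈ Finset.Icc 1 s, ((admissible p D).card : ℝ) *
              ((2 / (1 - Real.exp (-((κ / 2 - δ / 2 * ((D : ℝ) ^ 2 * Real.sqrt d)) / (p : ℕ) / Real.sqrt d))) *
                Real.exp ((κ / 2 - δ / 2 * ((D : ℝ) ^ 2 * Real.sqrt d)) / (p : ℕ) / Real.sqrt d)) ^ d) ^ (p - 1)) * ((A * Real.exp (δ / 2 * ((D : ℝ) ^ 2 * d)) * Real.exp (-(δ / (2 * ((k + 1 : ℕ) : ℝ)) / 2 * ((w : ℝ) + v + 1))) * ((L : ℝ) ^ d * (2 / (1 - Real.exp (-(δ / (2 * ((k + 1 : ℕ) : ℝ)) / 2 / Real.sqrt d))) * Real.exp (δ / (2 * ((k + 1 : ℕ) : ℝ)) / 2 / Real.sqrt d)) ^ d) *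
              ∑ p ∈ Finset.Icc 1 s, ((admissible p D).card : ℝ) *
              ((2 / (1 - Real.exp (-((κ / 2 - δ / 2 * ((D : ℝ) ^ 2 * Real.sqrt d)) / (p : ℕ) / Real.sqrt d))) *
                Real.exp ((κ / 2 - δ / 2 * ((D : ℝ) ^ 2 * Real.sqrt d)) / (p : ℕ) / Real.sqrt d)) ^ d) ^ (p - 1)) *
             (A * Real.exp (δ / 2 * ((D : ℝ) ^ 2 * d)) * ((L : ℝ) ^ d * (2 / (1 - Real.exp (-(δ / (2 * ((k + 1 : ℕ) : ℝ)) / Real.sqrt d))) * Real.exp (δ / (2 * ((k + 1 : ℕ) : ℝ)) / Real.sqrt d)) ^ d) *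
              ∑ p ∈ Finset.Icc 1 s, ((admissible p D).card : ℝ) *
              ((2 / (1 - Real.exp (-((κ / 2 - δ / 2 * ((D : ℝ) ^ 2 * Real.sqrt d)) / (p : ℕ) / Real.sqrt d))) *
                Real.exp ((κ / 2 - δ / 2 * ((D : ℝ) ^ 2 * Real.sqrt d)) / (p : ℕ) / Real.sqrt d)) ^ d) ^ (p - 1)) ^ (k - 1)))))
          + y₂ * ((3 : ℝ) ^ (k + 1) *
        (2 ^ ((k + 1) * D) * 2 ^ 2 ^ ((k + 1) * D) * (max 1 (freeCov d α β 0 0)) ^ ((k + 1) * D) *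
            Real.exp (-(δ / 2 * ((v : ℝ) + 1))) *
          (A * Real.exp (δ / 2 * ((D : ℝ) ^ 2 * d)) * (L : ℝ) ^ d * ∑ p ∈ Finset.Icc 1 s, ((admissible p D).card : ℝ) *
              ((2 / (1 - Real.exp (-((κ / 2 - δ / 2 * ((D : ℝ) ^ 2 * Real.sqrt d)) / (p : ℕ) / Real.sqrt d))) *
                Real.exp ((κ / 2 - δ / 2 * ((D : ℝ) ^ 2 * Real.sqrt d)) / (p : ℕ) / Real.sqrt d)) ^ d) ^ (p - 1)) ^ (k + 1)))) / (k + 1)! : ℝ)) := by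
  refine Finset.sum_le_sum fun k _ => div_le_div_of_nonneg_right ?_ (by positivity)
  exact add_le_add (add_le_add (add_le_add
    (add_le_add (cumbHl_le (s := s) (w := w) (α := α) (β := β) hA hδ hres k h₁)
      (cumbPsi3_le (s := s) (L := L) (v := v) (α := α) (β := β) hA hδ hres k h₂))
    (add_le_add (cumbRem_le (s := s) (w := w) (α := α) (β := β) hA hδ hres k h₃)
      (cumbCorr_le (s := s) (L := L) (v := v) (α := α) (β := β) hA hδ hres k h₂)))
    (cumbCross_le (s := s) (L := L) (w := w) (v := v) (α := α) (β := β) hA hδ hres k h₂))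
    (cumbW29_le (s := s) (L := L) (v := v) (α := α) (β := β) hA hδ hres k h₂)

section Assembly

variable {α β : ℝ} {s D : ℕ} {κ : ℝ}

set_option maxHeartbeats 800000 in -- the closed ledger hypothesis is a very large term
/-- ★ **(4.7) FROM THE CLOSED LEDGER.**  For `J ⊆ I`, `I ≠ ∅`, pavement parameters `L, w, v` (`2(2w+v) < L`, `(d+1)·2(2w+v) ≤ L`, `v ≤ w`, `1 ≤ w`),
contraction `γ ∈ [0,1]` with `γ(1+2d/α²) ≤ ½`, cut-off `b` with `γ^{d+1} b ≥ 1` and `L^d e^{−(γ^d b)²/4} ≤ 1/6`, rate `δ`, and Appendix A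
below `γ^{d+1} b`: if the CLOSED per-step errors — structural `S₁A b_n^D(e^{−ϰw/4}|I| + e^{−ϰw/4}|I|L^d + e^{−ϰv/4}|I|L^d)`, per-box `|I|·ErrPB(b_n)`
and cumulant-side `CUMB(|I|,|I|,|I|L^d)` at `b_n = γ^n b`, `n ≤ d` — plus the Appendix-A term `|I|k₁e^{−k₂ b_{d+1}²}` total at most
`|I|·errTerm S ρ₁ ρ₂ ρ₃ ρ₄ A b t` (`A = coefSup`), then (4.7) holds:
`exp(Σ_{k≤t} E^T_{P̂₀}(H_J;k)/k! − |I|·errTerm) ≤ ∫ χ^b_I e^{H_J} dP̂₀`.  Proof: clip `a` to `J`; chain `J_{n+1} = (J_n + τ_n) ∩ Γ̄₁(B_n)` with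
`τ_n ≡ −2(2w+v)𝟙`, `a_{n+1} = (a_n − τ_n)|_{Γ̄₁}`, `b_n = γ^n b`; `exists_lower_step` at each frame-`n` datum; `ineq47_of_chain`; cardinalities by `|I|`.
[cite: BenfattoEtAl1978, Basic Lemma (4.7) p.152; §5 pp.154–159 «Collecting all the errors»; Appendix A p.160] -/
theorem ineq47_of_ledger (hα : 0 < α) (hβ : 0 < β) (hvar : freeCov d α β 0 0 ≤ 1 / 2) (hd : 0 < d) (hκ : 0 < κ)
    {I J : Finset (B1Eq324BenfattoLemma.Site d)} (hJI : J ⊆ I) (hI : I.Nonempty) (a : Coef d) {A : ℝ} (hAdef : A = coefSup s D a J)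
    {L w v : ℕ} (hL2 : 2 * (2 * w + v) < L) (hfit : (d + 1) * (2 * (2 * w + v)) ≤ L) (hv : v ≤ w) (hw : 1 ≤ w)
    {b γ : ℝ} (hγ0 : 0 ≤ γ) (hγ1 : γ ≤ 1) (hγc : γ * (1 + 2 * d / α ^ 2) ≤ 1 / 2) (hb1 : 1 ≤ γ ^ (d + 1) * b)
    (hsmall : ((L : ℝ) ^ d) * Real.exp (-((γ ^ d * b) ^ 2 / 4)) ≤ 1 / 6)
    {δ : ℝ} (hδ : 0 < δ) (hδle : δ ≤ Real.log ((2 * d + α ^ 2) / (2 * d))) (hres : 0 < κ / 2 - δ / 2 * ((D : ℝ) ^ 2 * Real.sqrt d)) (t : ℕ)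
    {bbar k₁ k₂ : ℝ}
    (hAppA : ∀ c : ℝ, bbar < c → ∀ I' : Finset (B1Eq324BenfattoLemma.Site d), I'.Nonempty →
      Real.exp (-((I'.card : ℝ) * (k₁ * Real.exp (-(k₂ * c ^ 2))))) ≤ (P0 d α β).real (smallFieldSet I' c))
    (hbbar : bbar < γ ^ (d + 1) * b) {S ρ₁ ρ₂ ρ₃ ρ₄ : ℝ}
    (hledger : ∑ n ∈ Finset.range (d + 1),
        (((s1Const s D d κ * A * (γ ^ n * b) ^ D * Real.exp (-(κ / 4 * w)) * (I.card : ℝ)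
          + s1Const s D d κ * A * (γ ^ n * b) ^ D *
            (Real.exp (-(κ / 4 * w)) * ((I.card : ℝ) * (L : ℝ) ^ d) + Real.exp (-(κ / 4 * v)) * ((I.card : ℝ) * (L : ℝ) ^ d))) : ℝ)
          + ((I.card : ℝ) * ((let M : ℝ := A * (L : ℝ) ^ d * ∑ p ∈ Finset.Icc 1 s, ((admissible p D).card : ℝ) *
            ((2 / (1 - Real.exp (-(κ / 2 / (p : ℕ) / Real.sqrt d))) * Real.exp (κ / 2 / (p : ℕ) / Real.sqrt d)) ^ d) ^ (p - 1)
        let Mt : ℝ := A * Real.exp (δ / 2 * ((D : ℝ) ^ 2 * d)) * (L : ℝ) ^ d * ∑ p ∈ Finset.Icc 1 s, ((admissible p D).card : ℝ) *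
            ((2 / (1 - Real.exp (-((κ / 2 - δ / 2 * ((D : ℝ) ^ 2 * Real.sqrt d)) / (p : ℕ) / Real.sqrt d))) *
              Real.exp ((κ / 2 - δ / 2 * ((D : ℝ) ^ 2 * Real.sqrt d)) / (p : ℕ) / Real.sqrt d)) ^ d) ^ (p - 1)
        let K : ℝ := 4 * (s1Const s D d κ * A * (γ ^ n * b) ^ D * (L : ℝ) ^ d)
        let ε : ℝ := s1Const s D d κ * A * (γ ^ n * b) ^ D * Real.exp (-(κ / 4 * v)) * (L : ℝ) ^ d
        let W : ℝ := 3 * (((L : ℝ) ^ d) * Real.exp (-((γ ^ n * b) ^ 2 / 4)))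
        let cχ : ℕ → ℝ := fun k => 2 ^ k * ((∑ π ∈ setPartitions (univ : Finset (Fin k)), ((π.card - 1)! : ℝ)) *
            ((min 1 (2 * ((L : ℝ) ^ d) * Real.exp (-((γ ^ n * b) ^ 2 / 4)))) ^ ((2 * k : ℕ) : ℝ)⁻¹ *
              ((1 + (1 + 2 * d / α ^ 2) * (γ * (γ ^ n * b))) ^ D * M * momentConst D (2 * k) (freeCov d α β 0 0).toNNReal) ^ k))
        let K₀ : ℝ := max (max 1 (freeCov d α β 0 0)) ((1 + 2 * d / α ^ 2) * (γ * (γ ^ n * b)))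
        let ε₃₁ : ℝ := max (β * (2 * d * (freeCov d α β 0 0 * (2 * d / (2 * d + α ^ 2)) ^ (w - v))) *
              (γ * (γ ^ n * b) * ((L : ℝ) ^ d * (1 + Real.sqrt d * ((L : ℝ) - 1)))))
            (2 * d * freeCov d α β 0 0 * (2 * d / (2 * d + α ^ 2)) ^ (w - v) / α ^ 2)
        let δ₂₉ : ℕ → ℝ := fun k => 2 ^ (k * D) * 2 ^ 2 ^ (k * D) * K₀ ^ (k * D) * Real.exp (-(δ / 2 * ((v : ℝ) + 1))) * Mt ^ k
        let δ₃₁ : ℕ → ℝ := fun k => M ^ k * (2 ^ (k * D) * 2 ^ 2 ^ (k * D) * ((k * D : ℕ) * K₀ ^ (k * D) * ε₃₁))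
        let Err : ℝ := 2 * (2 ^ ((t + 1).choose 2) * K ^ (t + 1) / (t + 1)!) + Real.exp (2 * K) * W
            + ∑ k ∈ Finset.range t,
                (3 ^ (k + 1) * ((∑ π ∈ setPartitions (univ : Finset (Fin (k + 1))), ((π.card - 1)! : ℝ)) * (ε * K ^ k))
                  + 3 ^ (k + 1) * (cχ (k + 1) + δ₂₉ (k + 1)) + 3 ^ (k + 1) * (cχ (k + 1) + δ₃₁ (k + 1))) / (k + 1)!
        Err) : ℝ)
          + (            ∑ k ∈ Finset.range t,
          ((2 ^ (k + 1) * (2 ^ ((k + 1) * D) * 2 ^ 2 ^ ((k + 1) * D) * (max 1 (freeCov d α β 0 0)) ^ ((k + 1) * D)) *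
          ((A * Real.exp (δ / 2 * ((D : ℝ) ^ 2 * d)) *
              Real.exp (-((κ / 2 - δ / 2 * ((D : ℝ) ^ 2 * Real.sqrt d)) / 2 * w))) * (I.card : ℝ) *
            ∑ p ∈ Finset.Icc 1 s, ((admissible p D).card : ℝ) *
              ((2 / (1 - Real.exp (-((κ / 2 - δ / 2 * ((D : ℝ) ^ 2 * Real.sqrt d)) / 2 / (p : ℕ) / Real.sqrt d))) *
                Real.exp ((κ / 2 - δ / 2 * ((D : ℝ) ^ 2 * Real.sqrt d)) / 2 / (p : ℕ) / Real.sqrt d)) ^ d) ^ (p - 1)) *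
          (A * Real.exp (δ / 2 * ((D : ℝ) ^ 2 * d)) *
            ((1 : ℝ) * (2 / (1 - Real.exp (-(δ / (2 * ((k + 1 : ℕ) : ℝ)) / Real.sqrt d))) * Real.exp (δ / (2 * ((k + 1 : ℕ) : ℝ)) / Real.sqrt d)) ^ d) *
            ∑ p ∈ Finset.Icc 1 s, ((admissible p D).card : ℝ) *
              ((2 / (1 - Real.exp (-((κ / 2 - δ / 2 * ((D : ℝ) ^ 2 * Real.sqrt d)) / (p : ℕ) / Real.sqrt d))) *
                Real.exp ((κ / 2 - δ / 2 * ((D : ℝ) ^ 2 * Real.sqrt d)) / (p : ℕ) / Real.sqrt d)) ^ d) ^ (p - 1)) ^ k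
          + 2 ^ (k + 1) * (2 ^ ((k + 1) * D) * 2 ^ 2 ^ ((k + 1) * D) * (max 1 (freeCov d α β 0 0)) ^ ((k + 1) * D)) *
        ((I.card : ℝ) * (A * Real.exp (δ / 2 * ((D : ℝ) ^ 2 * d)) * Real.exp (-((κ / 2 - δ / 2 * ((D : ℝ) ^ 2 * Real.sqrt d)) / 2 * v)) *
          (L : ℝ) ^ d * ∑ p ∈ Finset.Icc 1 s, ((admissible p D).card : ℝ) *
              ((2 / (1 - Real.exp (-((κ / 2 - δ / 2 * ((D : ℝ) ^ 2 * Real.sqrt d)) / 2 / (p : ℕ) / Real.sqrt d))) *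
                Real.exp ((κ / 2 - δ / 2 * ((D : ℝ) ^ 2 * Real.sqrt d)) / 2 / (p : ℕ) / Real.sqrt d)) ^ d) ^ (p - 1))) *
        (A * Real.exp (δ / 2 * ((D : ℝ) ^ 2 * d)) *
          (2 / (1 - Real.exp (-(δ / (2 * ((k + 1 : ℕ) : ℝ)) / Real.sqrt d))) * Real.exp (δ / (2 * ((k + 1 : ℕ) : ℝ)) / Real.sqrt d)) ^ d *
          ∑ p ∈ Finset.Icc 1 s, ((admissible p D).card : ℝ) *
              ((2 / (1 - Real.exp (-((κ / 2 - δ / 2 * ((D : ℝ) ^ 2 * Real.sqrt d)) / (p : ℕ) / Real.sqrt d))) *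
                Real.exp ((κ / 2 - δ / 2 * ((D : ℝ) ^ 2 * Real.sqrt d)) / (p : ℕ) / Real.sqrt d)) ^ d) ^ (p - 1)) ^ k)
          + (2 ^ (k + 1) * (2 ^ ((k + 1) * D) * 2 ^ 2 ^ ((k + 1) * D) * (max 1 (freeCov d α β 0 0)) ^ ((k + 1) * D)) *
          (A * Real.exp (δ / 2 * ((D : ℝ) ^ 2 * d)) * Real.exp (-((κ / 2 - δ / 2 * ((D : ℝ) ^ 2 * Real.sqrt d)) / 2 * w)) *
            ((I.card : ℝ) * (L : ℝ) ^ d) * ∑ p ∈ Finset.Icc 1 s, ((admissible p D).card : ℝ) *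
              ((2 / (1 - Real.exp (-((κ / 2 - δ / 2 * ((D : ℝ) ^ 2 * Real.sqrt d)) / 2 / (p : ℕ) / Real.sqrt d))) *
                Real.exp ((κ / 2 - δ / 2 * ((D : ℝ) ^ 2 * Real.sqrt d)) / 2 / (p : ℕ) / Real.sqrt d)) ^ d) ^ (p - 1)) *
          (A * Real.exp (δ / 2 * ((D : ℝ) ^ 2 * d)) *
            (2 / (1 - Real.exp (-(δ / (2 * ((k + 1 : ℕ) : ℝ)) / Real.sqrt d))) * Real.exp (δ / (2 * ((k + 1 : ℕ) : ℝ)) / Real.sqrt d)) ^ d *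
            ∑ p ∈ Finset.Icc 1 s, ((admissible p D).card : ℝ) *
              ((2 / (1 - Real.exp (-((κ / 2 - δ / 2 * ((D : ℝ) ^ 2 * Real.sqrt d)) / (p : ℕ) / Real.sqrt d))) *
                Real.exp ((κ / 2 - δ / 2 * ((D : ℝ) ^ 2 * Real.sqrt d)) / (p : ℕ) / Real.sqrt d)) ^ d) ^ (p - 1)) ^ k
          + 2 ^ (k + 1) * (2 ^ ((k + 1) * D) * 2 ^ 2 ^ ((k + 1) * D) * (max 1 (freeCov d α β 0 0)) ^ ((k + 1) * D)) *
        ((I.card : ℝ) * (A * Real.exp (δ / 2 * ((D : ℝ) ^ 2 * d)) * Real.exp (-((κ / 2 - δ / 2 * ((D : ℝ) ^ 2 * Real.sqrt d)) / 2 * v)) *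
          (L : ℝ) ^ d * ∑ p ∈ Finset.Icc 1 s, ((admissible p D).card : ℝ) *
              ((2 / (1 - Real.exp (-((κ / 2 - δ / 2 * ((D : ℝ) ^ 2 * Real.sqrt d)) / 2 / (p : ℕ) / Real.sqrt d))) *
                Real.exp ((κ / 2 - δ / 2 * ((D : ℝ) ^ 2 * Real.sqrt d)) / 2 / (p : ℕ) / Real.sqrt d)) ^ d) ^ (p - 1))) *
        (A * Real.exp (δ / 2 * ((D : ℝ) ^ 2 * d)) *
          (2 / (1 - Real.exp (-(δ / (2 * ((k + 1 : ℕ) : ℝ)) / Real.sqrt d))) * Real.exp (δ / (2 * ((k + 1 : ℕ) : ℝ)) / Real.sqrt d)) ^ d *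
          ∑ p ∈ Finset.Icc 1 s, ((admissible p D).card : ℝ) *
              ((2 / (1 - Real.exp (-((κ / 2 - δ / 2 * ((D : ℝ) ^ 2 * Real.sqrt d)) / (p : ℕ) / Real.sqrt d))) *
                Real.exp ((κ / 2 - δ / 2 * ((D : ℝ) ^ 2 * Real.sqrt d)) / (p : ℕ) / Real.sqrt d)) ^ d) ^ (p - 1)) ^ k)
          + 2 ^ ((k + 1) * D) * 2 ^ 2 ^ ((k + 1) * D) * (max 1 (freeCov d α β 0 0)) ^ ((k + 1) * D) *
        ((I.card : ℝ) * (((k + 1 : ℕ) : ℝ) * (k : ℝ) *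
          ((A * Real.exp (δ / 2 * ((D : ℝ) ^ 2 * d)) * ((L : ℝ) ^ d * (2 / (1 - Real.exp (-(δ / (2 * ((k + 1 : ℕ) : ℝ)) / Real.sqrt d))) * Real.exp (δ / (2 * ((k + 1 : ℕ) : ℝ)) / Real.sqrt d)) ^ d) *
              ∑ p ∈ Finset.Icc 1 s, ((admissible p D).card : ℝ) *
              ((2 / (1 - Real.exp (-((κ / 2 - δ / 2 * ((D : ℝ) ^ 2 * Real.sqrt d)) / (p : ℕ) / Real.sqrt d))) *
                Real.exp ((κ / 2 - δ / 2 * ((D : ℝ) ^ 2 * Real.sqrt d)) / (p : ℕ) / Real.sqrt d)) ^ d) ^ (p - 1)) * ((A * Real.exp (δ / 2 * ((D : ℝ) ^ 2 * d)) * Real.exp (-(δ / (2 * ((k + 1 : ℕ) : ℝ)) / 2 * ((w : ℝ) + v + 1))) * ((L : ℝ) ^ d * (2 / (1 - Real.exp (-(δ / (2 * ((k + 1 : ℕ) : ℝ)) / 2 / Real.sqrt d))) * Real.exp (δ / (2 * ((k + 1 : ℕ) : ℝ)) / 2 / Real.sqrt d)) ^ d) *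
              ∑ p ∈ Finset.Icc 1 s, ((admissible p D).card : ℝ) *
              ((2 / (1 - Real.exp (-((κ / 2 - δ / 2 * ((D : ℝ) ^ 2 * Real.sqrt d)) / (p : ℕ) / Real.sqrt d))) *
                Real.exp ((κ / 2 - δ / 2 * ((D : ℝ) ^ 2 * Real.sqrt d)) / (p : ℕ) / Real.sqrt d)) ^ d) ^ (p - 1)) *
             (A * Real.exp (δ / 2 * ((D : ℝ) ^ 2 * d)) * ((L : ℝ) ^ d * (2 / (1 - Real.exp (-(δ / (2 * ((k + 1 : ℕ) : ℝ)) / Real.sqrt d))) * Real.exp (δ / (2 * ((k + 1 : ℕ) : ℝ)) / Real.sqrt d)) ^ d) *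
              ∑ p ∈ Finset.Icc 1 s, ((admissible p D).card : ℝ) *
              ((2 / (1 - Real.exp (-((κ / 2 - δ / 2 * ((D : ℝ) ^ 2 * Real.sqrt d)) / (p : ℕ) / Real.sqrt d))) *
                Real.exp ((κ / 2 - δ / 2 * ((D : ℝ) ^ 2 * Real.sqrt d)) / (p : ℕ) / Real.sqrt d)) ^ d) ^ (p - 1)) ^ (k - 1)))))
          + (I.card : ℝ) * ((3 : ℝ) ^ (k + 1) *
        (2 ^ ((k + 1) * D) * 2 ^ 2 ^ ((k + 1) * D) * (max 1 (freeCov d α β 0 0)) ^ ((k + 1) * D) *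
            Real.exp (-(δ / 2 * ((v : ℝ) + 1))) *
          (A * Real.exp (δ / 2 * ((D : ℝ) ^ 2 * d)) * (L : ℝ) ^ d * ∑ p ∈ Finset.Icc 1 s, ((admissible p D).card : ℝ) *
              ((2 / (1 - Real.exp (-((κ / 2 - δ / 2 * ((D : ℝ) ^ 2 * Real.sqrt d)) / (p : ℕ) / Real.sqrt d))) *
                Real.exp ((κ / 2 - δ / 2 * ((D : ℝ) ^ 2 * Real.sqrt d)) / (p : ℕ) / Real.sqrt d)) ^ d) ^ (p - 1)) ^ (k + 1)))) / (k + 1)! : ℝ)))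
        + (I.card : ℝ) * (k₁ * Real.exp (-(k₂ * (γ ^ (d + 1) * b) ^ 2)))
      ≤ (I.card : ℝ) * errTerm S ρ₁ ρ₂ ρ₃ ρ₄ A b t) :
    Ineq47 d α β t D s κ S ρ₁ ρ₂ ρ₃ ρ₄ b I J a := by
  subst hAdef
  have hA0 : 0 ≤ coefSup s D a J := coefSup_nonneg s D a J
  have hL : 0 < L := by omega
  have hb0 : 0 < b := by
    have h1 : 0 < γ ^ (d + 1) * b := by linarith
    by_contra hb
    have hb' : b ≤ 0 := not_lt.mp hb
    nlinarith [mul_le_mul_of_nonneg_left hb' (pow_nonneg hγ0 (d + 1))]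
  have hpowmono : ∀ k ≤ d + 1, γ ^ (d + 1) * b ≤ γ ^ k * b := fun k hk =>
    mul_le_mul_of_nonneg_right (pow_le_pow_of_le_one hγ0 hγ1 hk) hb0.le
  -- clip the coefficient to `J`
  obtain ⟨a', ha'J, ha'A, -, ha'H⟩ := exists_coefSupportedIn_clip s D a J
  -- the chain data
  set c : ℕ := 2 * (2 * w + v) with hc
  let τ : ℕ → B1Eq324BenfattoLemma.Site d := fun _ _ => -(c : ℤ)
  let Js : ℕ → Finset (B1Eq324BenfattoLemma.Site d) := fun k => Nat.rec (motive := fun _ => Finset (B1Eq324BenfattoLemma.Site d)) J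
    (fun k Jk => Jk.image (fun x => x + τ k) ∩ corridorsBar L w v ((Jk.image fun x => x + τ k).image (boxIndex L))) k
  let Bs : ℕ → Finset (B1Eq324BenfattoLemma.Site d) := fun k => ((Js k).image fun x => x + τ k).image (boxIndex L)
  let as : ℕ → Coef d := fun k => Nat.rec (motive := fun _ => Coef d) a'
    (fun k ak => restrictCoef (shiftCoef ak (-τ k)) (corridorsBar L w v (Bs k))) k
  let Is : ℕ → Finset (B1Eq324BenfattoLemma.Site d) := fun k => Nat.rec (motive := fun _ => Finset (B1Eq324BenfattoLemma.Site d)) I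
    (fun k Ik => Ik.image fun x => x + τ k) k
  let bs : ℕ → ℝ := fun k => Nat.rec (motive := fun _ => ℝ) b (fun _ bk => γ * bk) k
  have hrecJ : ∀ k < d + 1, Js (k + 1) = (Js k).image (fun x => x + τ k) ∩ corridorsBar L w v (Bs k) := fun k _ => rfl
  have hrecI : ∀ k < d + 1, Is (k + 1) = (Is k).image fun x => x + τ k := fun k _ => rfl
  have hreca : ∀ k < d + 1, as (k + 1) = restrictCoef (shiftCoef (as k) (-τ k)) (corridorsBar L w v (Bs k)) := fun k _ => rfl
  have hrecb : ∀ k < d + 1, bs (k + 1) = γ * bs k := fun k _ => rfl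
  have hB : ∀ k < d + 1, ((Js k).image fun x => x + τ k).image (boxIndex L) ⊆ Bs k := fun k _ => Finset.Subset.refl _
  have hbs : ∀ k, bs k = γ ^ k * b := fun k => by
    induction k with
    | zero => simp [bs]
    | succ k ih => show γ * bs k = _; rw [ih, pow_succ]; ring
  have hbk : ∀ k ≤ d + 1, 1 ≤ bs k := fun k hk => by rw [hbs]; exact hb1.trans (hpowmono k hk)
  have hsmk : ∀ k ≤ d, ((L : ℝ) ^ d) * Real.exp (-((bs k) ^ 2 / 4)) ≤ 1 / 6 := fun k hk => by
    refine le_trans (mul_le_mul_of_nonneg_left (Real.exp_le_exp.mpr ?_) (by positivity)) hsmall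
    have h1 : γ ^ d * b ≤ bs k := by rw [hbs]; exact mul_le_mul_of_nonneg_right (pow_le_pow_of_le_one hγ0 hγ1 hk) hb0.le
    have h0 : 0 ≤ γ ^ d * b := by positivity
    nlinarith [mul_le_mul h1 h1 h0 (h0.trans h1)]
  -- invariants along the chain
  have hinv := chain_invariants (L := L) (w := w) (v := v) (n := d + 1) ha'J ha'A hJI hrecJ hrecI hreca
  -- the separation of the shifted pavements
  have hsep : ∀ j j' : Fin (d + 1), j ≠ j' → ∀ (i : Fin d) (q : ℤ),
      (2 * (2 * w + v : ℕ) : ℤ) ≤ |(-(∑ i' ∈ Finset.range ((j : ℕ) + 1), τ i')) i - (-(∑ i' ∈ Finset.range ((j' : ℕ) + 1), τ i')) i - q * L| := by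
    intro j j' hjj' i q
    have h := sep_of_diagonalShifts (d := d) hfit j j' hjj' i q
    have e : ∀ n : ℕ, (-(∑ i' ∈ Finset.range (n + 1), τ i')) i = ((n : ℕ) + 1 : ℤ) * c := fun n => by
      rw [Pi.neg_apply, Finset.sum_apply]
      simp only [τ, Finset.sum_const, Finset.card_range, smul_neg, nsmul_eq_mul, neg_neg]
      push_cast; ring
    rw [e, e]; push_cast at h ⊢; exact h
  -- one lower step at every frame-`k` datum
  choose! ℓ Err hP using fun k (hk : k < d + 1) =>
    exists_lower_step (s := s) (D := D) (κ := κ) (L := L) (w := w) (v := v) (J := (Js k).image fun x => x + τ k)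
      (I := (Is k).image fun x => x + τ k) (a := shiftCoef (as k) (-τ k)) hα hβ hvar hd hκ
      (coefSupportedIn_frame (hinv k hk.le).1 (τ k)) (Finset.image_subset_image (hinv k hk.le).2.2.1) hA0
      (abs_shiftCoef_neg_le (hinv k hk.le).2.1 (τ k)) hL hL2 hv hw (hbk k hk.le) hγ0 hγ1 hγc (hsmk k (Nat.lt_succ_iff.mp hk)) hδ hδle hres t
  -- the goal in chain form (`bs 0 ≡ b`, `Is 0 ≡ I`, `Js 0 ≡ J` by `Nat.rec` computation)
  show Ineq47 d α β t D s κ S ρ₁ ρ₂ ρ₃ ρ₄ (bs 0) (Is 0) (Js 0) a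
  refine ineq47_of_chain (Js := Js) (Is := Is) (Bs := Bs) (as := as) (bs := bs) (τ := τ) hα hβ hκ hL hw hv hγ1 a (ha'H κ) ha'J ha'A hJI
    hrecJ hrecI hreca hrecb (fun k hk => hbk k hk.le) hB ℓ (fun k hk => (hP k hk).1) hsep hAppA hI (hbbar.trans_eq (hbs (d + 1)).symm)
    _ (fun k hk => (hP k hk).2.1) ?_
  -- the ledger: every cardinality by `|I|`, every `Err(□)` by `ErrPB`
  have hIs0 : Is 0 = I := rfl
  have hJs0 : Js 0 = J := rfl
  have hbs0 : bs 0 = b := rfl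
  simp only [hbs0, hIs0, hJs0] at hP ⊢
  simp only [hbs] at hP ⊢
  refine le_trans (add_le_add (Finset.sum_le_sum fun n hn => ?_) le_rfl) hledger
  have hn : n < d + 1 := Finset.mem_range.mp hn
  have hJn0 : ((Js n).card : ℝ) ≤ I.card := by exact_mod_cast (card_chain_le hrecJ n hn.le).trans (Finset.card_le_card hJI)
  have hJn : (((Js n).image fun x => x + τ n).card : ℝ) ≤ I.card := le_trans (by exact_mod_cast Finset.card_image_le) hJn0
  have hBn : ((Bs n).card : ℝ) ≤ I.card := le_trans (by exact_mod_cast card_boxes_le (L := L) (Js n) (τ n)) hJn0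
  have hCBn : ((corridorsBar L w v (Bs n)).card : ℝ) ≤ I.card * (L : ℝ) ^ d := by
    have h1 : ((corridorsBar L w v (Bs n)).card : ℝ) ≤ (Bs n).card * (L : ℝ) ^ d := by
      exact_mod_cast Literature.MathematicalPhysics.QuantumFieldTheory.Balaban1983to89.B1Eq324BenfattoSect5CollectErrors.card_corridorsBar_le
        (L := L) (w := w) (v := v) (Bs n)
    exact h1.trans (mul_le_mul_of_nonneg_right hBn (by positivity))
  have hS : 0 ≤ s1Const s D d κ := s1Const_nonneg s D d hκ.le
  have hbn0 : 0 ≤ γ ^ n * b := by positivity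
  have hErr := sum_le_card_mul (B := Bs n) (n := (I.card : ℝ)) (fun m hm => ((hP n hn).2.2 m).trans_le
      (perBoxErr_le (s := s) (D := D) (w := w) (v := v) hα hβ hκ.le hA0 hL (Finset.image_subset_image (hinv n hn.le).2.2.1) hm hγ0 hbn0 hres.le t))
      (errPB_nonneg (s := s) (D := D) (w := w) (v := v) hα hβ hκ.le hA0 hL hγ0 hbn0 hres.le t) hBn
  have hC := cumb_le (s := s) (D := D) (L := L) (w := w) (v := v) (t := t) (α := α) (β := β) hA0 hδ.le hres.le hJn hBn hCBn
  refine add_le_add ?_ (add_le_add hErr hC)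
  have hc2 : 0 ≤ s1Const s D d κ * coefSup s D a J * (γ ^ n * b) ^ D := by positivity
  have hc1 : 0 ≤ s1Const s D d κ * coefSup s D a J * (γ ^ n * b) ^ D * Real.exp (-(κ / 4 * w)) := by positivity
  exact add_le_add (mul_le_mul_of_nonneg_left hJn0 hc1) (mul_le_mul_of_nonneg_left (add_le_add
    (mul_le_mul_of_nonneg_left hCBn (Real.exp_pos _).le)
    (mul_le_mul_of_nonneg_left (mul_le_mul_of_nonneg_right hBn (by positivity)) (Real.exp_pos _).le)) hc2)

end Assembly

end Literature.MathematicalPhysics.QuantumFieldTheory.Balaban1983to89.B1Eq324BenfattoSect5LowerAssembly
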